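import Literature.IUT.HodgeArakelov.ThetaEnvDataRecordAutIntrinsic
import Literature.IUT.HodgeArakelov.EtaleThetaDataOfSettingAutActionInner

/-!
# [IUTchII] Prop 3.4 (i) at the GENUINE data, indexed by the conjugacy orbit of the action of ONE inversion
# automorphism `ι₀` of `Π^tp_{X̲̲}`: binder (P2) replaced by the ι-clause of Prop 2.2 (i)

S. Mochizuki, *Inter-universal Teichmüller theory II*, kurims manuscript (Dec. 2020): Prop 3.4 (i) pp. 91–92
[cite: Mochizuki2012, Prop 3.4 (i) p.91]; Prop 3.1 (i) p. 87 ("[`ι` ranges] over the inversion automorphisms of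
Proposition 2.2, (i)"); Prop 2.2 (i) p. 66 ("The collection of data `(Π_{v•} ⊆ Π_{v▶} ⊆ Π_v, ι)`, regarded up to
`Π_v`-conjugacy, may be reconstructed via a functorial group-theoretic algorithm from the topological group `Π_v`").
Claim key DISPUTED (D-0012); [EtTh] Cor. 2.18 (i) p. 60 = FACT-LIST F-0620, BY NAME.  abc-iut cell, layer L6, WAVE-5
seat abc-iut-w5-d169, holder sub-row «P34i-GENUINE-(P1)» of DAG node IUTchII:Prop3.4(i) (L6-lead §F v1.19s);
`plan/L6/SUBDAG-IUTchII-Prop-31-33-34.md`; GAP row G-w5d169-1.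

PROOF-ONLY corollary (no definitions, no `Prop`-valued definition, no named fact) of abc-iut-w5-d169's
`ThetaEnvDataRecordAutIntrinsic.lean` (p429735) and `EtaleThetaDataOfSettingAutActionInner.lean` (p430185): take the
inversion action to be the Π-INTRINSIC action `ρ := autActOfCor218i ι₀` of a topological automorphism `ι₀` of
`Π^tp_{X̲̲}` (abc-iut-w5-d072's representative `inversionAlpha` of a pointed inversion is such an `ι₀`; by
`pairRhoLim_eq_autActOfCor218i` its pair action IS `autActOfCor218i ι₀`).  Then binder (P2) `hρ` of
`prop34i_multiradiallyDefined_intrinsic` is `orbitHyp_of_iotaConj`, i.e. FOLLOWS from the purely group-theoretic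
`hconj : ∀ α ∈ Aut_top(Π^tp_{X̲̲}), ∃ c, α ∘ ι₀ ∘ α⁻¹ = conj c ∘ ι₀ ∘ conj c⁻¹` — the `ι`-clause of Prop 2.2 (i)
(GAP row G-w5d169-1: typed exactly, in-cone, to be PROVED by the Prop 2.2 (i) lineage).
* `EtaleLevels.autIsoActionOfInversion` — the `Aut(Π^tp_{X̲̲})`-action on the Prop 3.1 record indexed by the
  `Π^tp_{X̲̲}`-conjugacy orbit of `ρ_{ι₀}`;
* **`EtaleLevels.prop34i_multiradiallyDefined_ofInversion`** — [IUTchII] Prop 3.4 (i) multiradiality AT THE GENUINE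
  FUNCTOR with residual exactly: F-0620 (named FACT) · `hq` (interface topology) · `hconj` (G-w5d169-1) · (P3) `hκ`
  (Kummer image stable, [AbsTopIII] §3 class) · (P4) `hθ`/`hinf` (theta classes stable, [EtTh] Cor. 2.19 (iii) class) ·
  the record's standing inputs.
Nothing here asserts anything of [IUTchII]; no side taken on [IUTchIII] Cor 3.12; typed ≠ proved.
-/

noncomputable section

open Topology

namespace Literature.IUT.HodgeArakelov

open Literature.AnabelianGeometry.EtaleTheta Literature.AnabelianGeometry.SemiGraphs
open CohomologySystemOfContH1 EtaleThetaDataOfSetting TemperedThetaMonoids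
open scoped Literature.AnabelianGeometry.EtaleTheta

namespace EtaleLevels

variable {p : ℕ} [Fact p.Prime] {D : Literature.AnabelianGeometry.EtaleTheta.ThetaSetting p}
  {E : D.EtaleThetaData} {l : ℕ} (C : E.DoubleUnderline l) (hC : D.Compat) (hS : D.Sec2Hyps)
  (hl : l.Prime) (hp2 : p ≠ 2) (hpl : p ≠ l) (hζ : ∃ ζ : D.K, IsPrimitiveRoot ζ (4 * l))
  (mods : ∀ M : ℕ+, D.CyclotomeMod l M)
  (f : contCocycles D.toTheta D.DeltaTheta C.GtpYdduu) (hf : f ∈ C.rootCocycles hC)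
  (hmods : ∀ (M M' : ℕ+) (h : (M : ℕ) ∣ (M' : ℕ)) (x : D.lDeltaTheta l),
    MuN.red p M M' h ((mods M').red x) = (mods M).red x)
  (h15 : Literature.AnabelianGeometry.EtaleTheta.ThetaSetting.Prop15iii E hC) (L : C.CuspLabels)
  (hZ : ∀ M : ℕ+, Nonempty (ModelCyclotomes.lDeltaQuot (C.rigidData (mods M) hC hS h15 L) ≃*
    Literature.IUT.HodgeTheaters.ZHat))
  (hcharY : EtaleThetaDataOfSetting.PiYddCharacteristic C)
  (hlim : Function.Bijective (rigidLimHom C hC hS hl hp2 hpl hζ mods f hf hmods h15 L hZ))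
  [(EtaleThetaDataOfSetting.PiYdd C).Normal]
  (hq : IsQuotientMap D.toTheta) {N : ℕ+} (μ : D.CyclotomeMod l N)
  (R : RigidData.{0} N l) (hR : R = C.rigidData μ hC hS h15 L) (h218i : R.Cor218_i)
  {M : Type} [CommMonoid M]
  (κ : M →* Multiplicative (thetaEnvData C hC hS hl hp2 hpl hζ mods f hf hmods h15 L hZ hcharY hlim).cohEnv.lim)
  (ι₀ : (Pi C) ≃ₜ* (Pi C))
  (hconj : ∀ α : (Pi C) ≃ₜ* (Pi C), ∃ c : Pi C, ∀ g, α (ι₀ (α.symm g)) = c * ι₀ (c⁻¹ * g * c) * c⁻¹)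
  (hκ : ∀ α : (Pi C) ≃ₜ* (Pi C),
    (MonoidHom.mrange κ).map (AddEquiv.toMultiplicative (autActOfCor218i C hq μ hC hS h15 L R hR h218i α) :
      Multiplicative (h1Lim (phi C) (D.lDeltaTheta l) (PiYdd C) ⊥) →*
        Multiplicative (h1Lim (phi C) (D.lDeltaTheta l) (PiYdd C) ⊥)) = MonoidHom.mrange κ)
  (hθ : ∀ α : (Pi C) ≃ₜ* (Pi C), autActOfCor218i C hq μ hC hS h15 L R hR h218i α ''
    ((thetaEnvData C hC hS hl hp2 hpl hζ mods f hf hmods h15 L hZ hcharY hlim).D.coh.toLim ⊤ ''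
      (thetaEnvData C hC hS hl hp2 hpl hζ mods f hf hmods h15 L hZ hcharY hlim).D.theta) =
    (thetaEnvData C hC hS hl hp2 hpl hζ mods f hf hmods h15 L hZ hcharY hlim).D.coh.toLim ⊤ ''
      (thetaEnvData C hC hS hl hp2 hpl hζ mods f hf hmods h15 L hZ hcharY hlim).D.theta)
  (hinf : ∀ α : (Pi C) ≃ₜ* (Pi C), autActOfCor218i C hq μ hC hS h15 L R hR h218i α ''
    (thetaEnvData C hC hS hl hp2 hpl hζ mods f hf hmods h15 L hZ hcharY hlim).D.thetaInfty =
    (thetaEnvData C hC hS hl hp2 hpl hζ mods f hf hmods h15 L hZ hcharY hlim).D.thetaInfty)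

/-- **J10 for the orbit of ONE inversion automorphism `ι₀` of `Π^tp_{X̲̲}`**: the `Aut(Π^tp_{X̲̲_k})`-action by isomorphisms
on the Prop 3.1 record indexed by the `Π^tp_{X̲̲}`-conjugacy orbit of `ρ_{ι₀} = autActOfCor218i ι₀`, binder (P2) supplied
by `orbitHyp_of_iotaConj` from the group-theoretic `hconj`. [cite: Mochizuki2012, Prop 3.4 (i) p.91] -/
def autIsoActionOfInversion :
    TemperedThetaMonoids.ThetaEnvData.AutIsoAction
      (thetaEnvRecordOrbit C hC hS hl hp2 hpl hζ mods f hf hmods h15 L hZ hcharY hlim κ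
        (autActOfCor218i C hq μ hC hS h15 L R hR h218i ι₀)) :=
  autIsoActionOrbitI C hC hS hl hp2 hpl hζ mods f hf hmods h15 L hZ hcharY hlim hq μ R hR h218i κ
    (autActOfCor218i C hq μ hC hS h15 L R hR h218i ι₀)
    (orbitHyp_of_iotaConj C hq μ hC hS h15 L R hR h218i ι₀ hconj) hκ hθ hinf

/-- **[IUTchII] Prop 3.4 (i) — MULTIRADIALITY OF SPLIT THETA MONOIDS AT THE GENUINE FUNCTOR, `ι` ranging over the
`Π^tp_{X̲̲}`-conjugacy orbit of the action of ONE inversion automorphism `ι₀`** — with binder (P1) discharged to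
{[EtTh] Cor. 2.18 (i) (F-0620), `hq`} (p429735) and binder (P2) reduced to the `ι`-clause `hconj` of Prop 2.2 (i)
(GAP row G-w5d169-1). Remaining binders: (P3) `hκ`, (P4) `hθ`/`hinf`. [cite: Mochizuki2012, Prop 3.4 (i) p.92] -/
theorem prop34i_multiradiallyDefined_ofInversion
    {η : (C.thetaEnvData μ hC hS).PiYdd → MuN p N} (hη : η ∈ (C.thetaEnvData μ hC hS).thetaCocycles)
    (Γ : Type) [Group Γ] :
    ((ex18iii (ThetaSetting.ofDoubleUnderline C μ hC hS hl hp2 hpl hζ hη) Γ).toDagger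
      (TemperedThetaMonoids.prop34iRadialFunctor
        (thetaEnvTransportI C hC hS hl hp2 hpl hζ mods f hf hmods h15 L hZ hcharY hlim hq μ R hR h218i κ
          (autActOfCor218i C hq μ hC hS h15 L R hR h218i ι₀)
          (orbitHyp_of_iotaConj C hq μ hC hS h15 L R hR h218i ι₀ hconj) hκ hθ hinf hη)
        Γ)).IsMultiradiallyDefined :=
  prop34i_multiradiallyDefined_intrinsic C hC hS hl hp2 hpl hζ mods f hf hmods h15 L hZ hcharY hlim hq μ R hR h218i κ
    _ _ hκ hθ hinf hη Γ

end EtaleLevels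

end Literature.IUT.HodgeArakelov

end
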